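import Summits.BirchSwinnertonDyer.BirchSwinnertonDyer.Theorems.GenusKolyvaginAtTwoPowDvdShaCardAtTwoRTKolyvaginSuppliesOfDeepSwap
import Summits.BirchSwinnertonDyer.BirchSwinnertonDyer.Theorems.GenusKolyvaginAtTwoPowDvdShaCardAtTwoRTEigenIndexSocket
import HarnessLib

/-!
# Route `GenusKolyvaginAtTwo`, LINE 18 (L_T `PowDvdShaCardAtTwoRT`, stmt-BirchSwinnertonDyer-23242), stub KS / stub L BY NAME modulo
# TWO sockets: the bottom rung and the exact swap — the margin class fixed, the eigen index law discharged, the swap socket in the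
# orientation of LEAD's `exactSwap_core`

Seat `bsd-line-gk2-p2` g19 (PROVER seat 2/3, cell `bsd-f1-sign2`), `--supports stmt-BirchSwinnertonDyer-23242` (helper; closes nothing).
THEOREMS ONLY (no definition, no named fact, no `sorry`); BSD is not proved by any of this; neither is stub KS nor stub L (two sockets stay open).

WHAT. `…RTKolyvaginSuppliesOfDeepSwap` (p727242) gives stub KS's registered conclusion and stub L's from three displayed sockets `hbot`,
`hswap`, `hK` over a class «(Zhang–Kolyvagin ∧ L ≤ index) ∧ G».  Here the class is FIXED to LEAD g18's ruling (R2) margin class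
`G q := L + k ≤ index q ∧ FrobEqFrobInfty W K (2^(L+k)) q`; the socket `hK` is DISCHARGED by gk2-p5 g24's `hK_socket_margin` (p727553,
`…RTEigenIndexSocket`, over g23's `relIndex_iInf_torsionLocalKer_inf_torsionBy_two_dvd_two`); and the swap socket is restated in the
ORIENTATION OF LEAD's `exactSwap_core` (`…RTExactSwapCore`, p727522): the swapped level written `n / ℓ₀ * ℓ′` and the detection clause for
EVERY place over `ℓ′` (the dictionary to p727242's `ℓ′ * (n / ℓ₀)` / `∃ v` form is `KolyvaginHeegnerData`-transport along
`Nat.mul_comm` — `kolyvaginClass_cast` — and `VisiblePairAtTwo.exists_natCast_mem`).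
* `kolyvaginClass_cast` — the class of a datum transported along an equality of levels is unchanged;
* `twinShaLadders_of_exactSwap` — stub L's conclusion on its own binders at a level `L ≥ M₀ + 1`, margin `k`, granted Q2 and (NPh_{L+k}),
  from **`hbot`** (a square-free level of the margin class with a 2-primitive datum, `addOrderOf c_L(d) = 2^L` — LEAD's bottom rung) and
  **`hswap`** (LEAD's `exactSwap_core` conclusion shape, quantified as in p727242: `∀ r m, 1 ≤ r → m < M₀ → minimality → …`).
Namespace `…Theorems.GenusExact.PlusDescent`.  Closes nothing.  BSD is NOT proved by any of this.

References: [McCallumLMS1991] §5 Prop. 5.2, Lemma 5.3, Thm. 5.4; [Kolyvagin1991MathAnn] Thm. 2.1; [GrossLMS1991] §3 (3.1)–(3.3), §4 (4.1).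
-/

set_option autoImplicit false
-- the Theorems namespace of this sub repeats the summit name by design (D-0017 nested layout)
set_option linter.dupNamespace false

noncomputable section

open scoped Classical

namespace Summit.BirchSwinnertonDyer.BirchSwinnertonDyer.Theorems.GenusExact.PlusDescent

open WeierstrassCurve NumberField IsDedekindDomain Field Literature.NumberTheory.EllipticCurves
  Literature.NumberTheory.GaloisRepresentations Literature.NumberTheory.EllipticCurves.ModularForms AddSubgroup
open Summit.BirchSwinnertonDyer.BirchSwinnertonDyer.Theses.GenusKolyvaginAtTwo (KolyvaginRelationAtTwo)

variable {K : Type} [Field K] [NumberField K]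

/-- Transporting a Kolyvagin–Heegner datum along an equality of levels does not change its class. [folklore] -/
theorem kolyvaginClass_cast {W : WeierstrassCurve ℚ} [W.IsElliptic] {N : ℕ} [NeZero N]
    {Dt : ModularParametrizationData W N} {β : ℤ} {ι : K →+* ℂ} {m m' : ℕ} (h : m = m')
    (d : KolyvaginHeegnerData Dt β ι m) {p : ℕ} (hp : p.Prime) (M : ℕ) :
    (h ▸ d).kolyvaginClass hp M = d.kolyvaginClass hp M := by
  subst h
  rfl

/-- **STUB L's CONCLUSION FROM THE BOTTOM RUNG AND THE EXACT SWAP** at a level `L ≥ M₀ + 1` with margin `k`, over the margin class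
«Zhang–Kolyvagin ∧ `L + k ≤ index` ∧ `FrobEqFrobInfty W K (2^(L+k))`» (LEAD g18 (R2): `k = 1`), granted Q2 and (NPh_{L+k}); the eigen index law
is gk2-p5's `hK_socket_margin`, the minima are `RelaxedCount.exists_kolyvaginMinima_pred`, the loop and the descent layer are p727242.
`hswap` is the conclusion shape of LEAD's `exactSwap_core` (`…RTExactSwapCore`): the swapped level `n / ℓ₀ * ℓ′`, detection at every place
over `ℓ′`. [cite: McCallumLMS1991, §5 Prop. 5.2, Thm. 5.4] [cite: Kolyvagin1991MathAnn, Thm. 2.1] [cite: GrossLMS1991, Thm. 1.3, §4 (4.1)] -/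
theorem twinShaLadders_of_exactSwap (hP : PubInputsAtTwo) (hQ2 : KolyvaginRelationAtTwo)
    (W : WeierstrassCurve ℚ) [W.IsElliptic] [W.IsGloballyMinimal] [NeZero (W.conductorNorm ℤ)] (hcm : ¬ W.HasCM) (hΔ : W.Δ < 0)
    (hT : Odd W.tamagawaProduct) (K : Type) [Field K] [NumberField K] (hIQ : IsImaginaryQuadratic K)
    (hodd : Odd (NumberField.discr K)) (h3 : NumberField.discr K ≠ -3) (hHe : SatisfiesHeegnerHypothesis (W.conductorNorm ℤ) K)
    (hns : ¬ IsSquare ((NumberField.discr K : ℚ) * -|W.Δ|))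
    (hρ : ∀ n : ℕ, 0 < n → W.HasSurjectiveModNGaloisRep ((2 : ℤ) ^ n))
    (Dt : ModularParametrizationData W (W.conductorNorm ℤ)) (β : ℤ) (ι : K →+* ℂ) (d₁ : KolyvaginHeegnerData Dt β ι 1)
    (hy : ¬ IsOfFinAddOrder d₁.derivedPoint) (M₀ : ℕ)
    (hM₀ : ∃ Q : (W.baseChange (ringClassField K ι 1)).toAffine.Point, ((2 ^ M₀ : ℕ) : ℤ) • Q = d₁.derivedPoint)
    (hndiv : ¬ ∃ Q : (W.baseChange (ringClassField K ι 1)).toAffine.Point, ((2 ^ (M₀ + 1) : ℕ) : ℤ) • Q = d₁.derivedPoint)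
    (Wd : WeierstrassCurve ℚ) [Wd.IsElliptic] (hTw : ∃ C : VariableChange ℚ, C • W.quadraticTwist (NumberField.discr K : ℚ) = Wd)
    {L : ℕ} (hML : M₀ + 1 ≤ L) (k : ℕ)
    (hNPh : ∀ z : galH1Torsion (W.baseChange K) ((2 ^ (L + k) : ℕ) : ℤ),
      (∀ ρ' ∈ torsionFixing (W.baseChange K) ((2 ^ (L + k) : ℕ) : ℤ), h1Eval (W.baseChange K) ((2 ^ (L + k) : ℕ) : ℤ) z ρ' = 0) →
      (∀ w : HeightOneSpectrum (𝓞 K), z ∈ selmerLocalKer (W.baseChange K) (w.adicCompletion K) ((2 ^ (L + k) : ℕ) : ℤ)) → z = 0)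
    (hbot : ∃ (n : ℕ) (d : KolyvaginHeegnerData Dt β ι n), Squarefree n ∧
      (∀ q ∈ n.primeFactors, (Zhang2014.IsKolyvaginPrime (W.conductorNorm ℤ) W K 2 q ∧ L ≤ Zhang2014.kolyvaginIndex W 2 q) ∧
        (L + k ≤ Zhang2014.kolyvaginIndex W 2 q ∧ FrobEqFrobInfty W K (2 ^ (L + k)) q)) ∧
      addOrderOf (d.kolyvaginClass Nat.prime_two L) = 2 ^ L)
    (hswap : ∀ τ : K ≃ₐ[ℚ] K, τ ≠ 1 → ∀ (r m : ℕ), 1 ≤ r → m < M₀ →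
      (∀ (n : ℕ) (e : KolyvaginHeegnerData Dt β ι n), Squarefree n → n.primeFactors.card = r →
        (∀ q ∈ n.primeFactors, (Zhang2014.IsKolyvaginPrime (W.conductorNorm ℤ) W K 2 q ∧ L ≤ Zhang2014.kolyvaginIndex W 2 q) ∧
          (L + k ≤ Zhang2014.kolyvaginIndex W 2 q ∧ FrobEqFrobInfty W K (2 ^ (L + k)) q)) →
        ((2 ^ (L - m) : ℕ) : ℤ) • e.kolyvaginClass Nat.prime_two L = 0) →
      ∀ (n : ℕ) (d : KolyvaginHeegnerData Dt β ι n), Squarefree n → n.primeFactors.card = r →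
      (∀ q ∈ n.primeFactors, (Zhang2014.IsKolyvaginPrime (W.conductorNorm ℤ) W K 2 q ∧ L ≤ Zhang2014.kolyvaginIndex W 2 q) ∧
        (L + k ≤ Zhang2014.kolyvaginIndex W 2 q ∧ FrobEqFrobInfty W K (2 ^ (L + k)) q)) →
      addOrderOf (d.kolyvaginClass Nat.prime_two L) = 2 ^ (L - m) →
      ∀ ℓ₀ ∈ n.primeFactors, ∀ X : Finset ℕ, ∃ ℓ' : ℕ, ℓ' ∉ X ∧ ℓ' ∉ n.primeFactors ∧
        Zhang2014.IsKolyvaginPrime (W.conductorNorm ℤ) W K 2 ℓ' ∧ L + k ≤ Zhang2014.kolyvaginIndex W 2 ℓ' ∧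
        FrobEqFrobInfty W K (2 ^ (L + k)) ℓ' ∧
        (∀ v : HeightOneSpectrum (𝓞 K), ((ℓ' : ℕ) : 𝓞 K) ∈ v.asIdeal →
          ((2 ^ (L - m - 1) : ℕ) : ℤ) • d.kolyvaginClass Nat.prime_two L ∉
            (W.baseChange K).torsionLocalKer (v.adicCompletion K) ((2 ^ L : ℕ) : ℤ)) ∧
        ∃ d' : KolyvaginHeegnerData Dt β ι (n / ℓ₀ * ℓ'),
          ((2 ^ (L - m - 1) : ℕ) : ℤ) • d'.kolyvaginClass Nat.prime_two L ≠ 0) :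
    ∃ (T : ℕ) (M : ℕ → ℕ), (∀ j, M (j + 1) ≤ M j) ∧ M 0 = M₀ ∧ M (2 * T) = 0 ∧
      (∀ m < T, ∃ x : Fin (2 * m + 2) → W.galH1, (∀ i, resBaseChange W K (x i) ∈ (W.baseChange K).sha) ∧
        (∀ i, addOrderOf (x i) = 2 ^ (M (2 * m) - M (2 * m + 1))) ∧
        ∀ c : Fin (2 * m + 2) → ℤ, ∑ i, c i • x i = 0 → ∀ i, ((2 ^ (M (2 * m) - M (2 * m + 1)) : ℕ) : ℤ) ∣ c i) ∧
      (∀ m < T, ∃ x : Fin (2 * m + 2) → Wd.galH1, (∀ i, resBaseChange Wd K (x i) ∈ (Wd.baseChange K).sha) ∧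
        (∀ i, addOrderOf (x i) = 2 ^ (M (2 * m + 1) - M (2 * m + 2))) ∧
        ∀ c : Fin (2 * m + 2) → ℤ, ∑ i, c i • x i = 0 → ∀ i, ((2 ^ (M (2 * m + 1) - M (2 * m + 2)) : ℕ) : ℤ) ∣ c i) := by
  have hL : 1 ≤ L := by omega
  refine twinShaLadders_of_deepSwap hP hQ2 W hcm hΔ hT K hIQ hodd h3 hHe hns hρ Dt β ι d₁ hy M₀ hM₀ hndiv Wd hTw hML k hNPh
    (fun q ↦ L + k ≤ Zhang2014.kolyvaginIndex W 2 q ∧ FrobEqFrobInfty W K (2 ^ (L + k)) q) (fun q _ hidx hF ↦ ⟨hidx, hF⟩) hbot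
    (fun τ hτ r m hr hm hminr n d hn hcard hadm hord ℓ₀ hℓ₀ X ↦ ?_)
    (fun τ hτ r ℓ hℓ C hC ↦ hK_socket_margin W hΔ hIQ hτ hL r k ℓ hℓ C hC)
  -- the swap socket in LEAD's orientation ⟹ p727242's
  obtain ⟨ℓ', hℓ'X, hℓ'n, hKol, hidx, hF, hdet, d', hd'⟩ := hswap τ hτ r m hr hm hminr n d hn hcard hadm hord ℓ₀ hℓ₀ X
  obtain ⟨v, hv⟩ := VisiblePairAtTwo.exists_natCast_mem (K := K) hKol.1
  refine ⟨ℓ', hℓ'X, hℓ'n, ⟨⟨hKol, le_trans (Nat.le_add_right L k) hidx⟩, hidx, hF⟩, ⟨v, hv, hdet v hv⟩,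
    Nat.mul_comm (n / ℓ₀) ℓ' ▸ d', ?_⟩
  rw [kolyvaginClass_cast]
  exact hd'

end Summit.BirchSwinnertonDyer.BirchSwinnertonDyer.Theorems.GenusExact.PlusDescent

end
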